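import Summits.Parity.GeneralizedHardyLittlewood.Theorems.LeeYangFibresCellParityLawSavingEngineDefs
import Summits.Parity.GeneralizedHardyLittlewood.Theorems.LeeYangFibresCellParityLawGeThreeAssembly
import Summits.Parity.GeneralizedHardyLittlewood.Theorems.LeeYangFibresCellParityLawPrLawTwoPrep
import Summits.Parity.GeneralizedHardyLittlewood.Theorems.LeeYangFibresAbsoluteUpgradeQuantClipNumerics
import Summits.Parity.GeneralizedHardyLittlewood.Theorems.LeeYangFibresCellParityLawSavingWalshStep
import HarnessLib

/-!
# Route `LeeYangFibres`, crux `CellParityLawSaving` (stmt-Parity-18104), line `superpoly-band-same-atom`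
# (payload slug `SketchIdeator3`): the registered stub `stub_assemblyAlong` — the assembly of Bombieri's
# one-parameter section law ALONG THE SCHEDULE

We prove `AssemblyAlong` (vocabulary `LeeYangFibresCellParityLawSavingEngineDefs`): the raw section law on
the localised body (`RawSectionLawSavAt t`, saving `(log N)^{-δ_raw}`), the main-term conversion along the
schedule (`MainTermConversionAlong`), the preparations (`PrepAlong`: degenerate cases, Euler ratio
`H = 𝔖/𝔖₋ᵢ`, fibre mass `F ≤ N (log N)^ε/log^t N` from the `t`-form law), the singular-series bookkeeping
(`SingularRatioBound`: `H ≤ C_s (log log N)^D`), the anatomy bounds (`DensityBoundsAlong`: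
`a_m ≤ (log N)^ε/log N`) and the `secSeqB` localisation identities (`SectionSeqBFacts`, `SectionSeqBCells`)
give Bombieri's one-parameter section law along the schedule `u = U(N) = slowDegree N` with the
singular-series RATIO, `SectionLawSavAt t`, with saving `(log N)^{-2ε}`, `ε = min(δ_raw, 1/2)/8`.

Proof: a port of the sister's `stub_geThreeAssembly` (`LeeYangFibresCellParityLawGeThreeAssembly`) with the
quarter budget `Q = N/(8 log^{t+1} N · P²)`, `P = (log N)^ε`.  Degenerate coordinate: every cell vanishes and
`H · F = 0` (`PrepAlong` (a)), and `H · F = (𝔖/𝔖₋ᵢ) · F` (`PrepAlong` (b); `𝔖/0 = 0`).  Otherwise localise the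
body to `K' = K ∩ {ψ_i > x/Λ}` (`x = 2LN`, `Λ = (log N)^{t+2}`): cells and fibre mass change by
`≤ x/Λ + 1 ≤ 2Q`.  If the localised mass is `< N/log^{t+2} N ≤ Q`, every cell and the model are `≤ 3Q`
(cells `≤` fibre mass, `PrLawTwoAux.cell_le_sectionMass`, as `N^{1/U(N)} ≥ 2` along the schedule).  Otherwise
the raw law gives ONE `δ'`; with `H ≤ C_s (log log N)^D ≤ C_s P`, `e^γ V ≤ H P/log N`, `F' ≤ N P/log^t N`,
`a_m ≤ P/log N` and the thresholds `8 C_s + 16 L + 8 ≤ P`, `P⁶ ≤ log N`, `P⁸ ≤ (log N)^{δ_raw}`,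
`8 log^{t+2} N ≤ N` (all eventually: `WalshStepSavAux.exists_thresholds`,
`GeThreeAssemblyAux.eventually_logpow_le_self`), the raw error `V F'/(log N)^{δ_raw} + N/log^{t+2} N`, the
conversion error `H F' P/log² N` and the two localisation errors are each `≤ 2Q` (`AssemblyAlongAux.budget`,
pure real arithmetic).  No number theory is used beyond the hypotheses.

References: E. Bombieri, Rend. Accad. Naz. XL (5) 1/2 (1975/76) [BombieriAsymptoticSieve1976]; E. Bombieri,
RIMS Kôkyûroku 294 (1977) p. 5 [BombieriRIMS1977]; J. Friedlander, H. Iwaniec, Ann. Sc. Norm. Sup. Pisa (4) 5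
(1978) §4 [FriedlanderIwaniecPisa1978].
-/

noncomputable section

open scoped BigOperators Classical
open Finset Filter Literature.NumberTheory.Sieve
open Summit.Parity.GeneralizedHardyLittlewood.Cruxes.CellParityLaw.SectionAnnihilator
open Summit.Parity.GeneralizedHardyLittlewood.Cruxes.AbsoluteUpgrade.DipMarginRateExchange (slowDegree
  four_le_slowDegree quantClip_schedule)

namespace Summit.Parity.GeneralizedHardyLittlewood.Cruxes.CellParityLawSaving.SuperPolyBand

namespace AssemblyAlongAux

/-- **Exponent bookkeeping.** With `ε = min(δ_raw, 1/2)/8` and `P = ℓ^ε` (`ℓ ≥ 1`): `P ≥ 1`,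
`ℓ^{2ε} = P²`, `P⁸ ≤ ℓ^{δ_raw}` and `P⁶ ≤ ℓ`. -/
theorem powers {ℓ δr ε : ℝ} (hℓ : 1 ≤ ℓ) (hδr : 0 < δr) (hε : ε = min δr (1 / 2) / 8) :
    1 ≤ ℓ ^ ε ∧ ℓ ^ (2 * ε) = (ℓ ^ ε) ^ 2 ∧ (ℓ ^ ε) ^ 8 ≤ ℓ ^ δr ∧ (ℓ ^ ε) ^ 6 ≤ ℓ := by
  have hℓ0 : 0 ≤ ℓ := zero_le_one.trans hℓ
  have hm0 : 0 < min δr (1 / 2) := lt_min hδr one_half_pos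
  have hε0 : 0 ≤ ε := by rw [hε]; positivity
  have h8 : ε * ((8 : ℕ) : ℝ) ≤ δr := by
    rw [hε]; push_cast; linarith [min_le_left δr (1 / 2)]
  have h6 : ε * ((6 : ℕ) : ℝ) ≤ 1 := by
    rw [hε]; push_cast; linarith [min_le_right δr (1 / 2)]
  refine ⟨Real.one_le_rpow hℓ hε0, ?_, ?_, ?_⟩
  · rw [← Real.rpow_natCast, ← Real.rpow_mul hℓ0]
    congr 1
    push_cast
    ring
  · rw [← Real.rpow_natCast, ← Real.rpow_mul hℓ0]
    exact Real.rpow_le_rpow_of_exponent_le hℓ h8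
  · rw [← Real.rpow_natCast, ← Real.rpow_mul hℓ0]
    calc ℓ ^ (ε * ((6 : ℕ) : ℝ)) ≤ ℓ ^ (1 : ℝ) := Real.rpow_le_rpow_of_exponent_le hℓ h6
      _ = ℓ := Real.rpow_one ℓ

/-- **`N^{1/U} ≥ 2` along the schedule**: from `exp(4U²) ≤ log N` and `U ≥ 4`,
`N^{1/U} = exp(log N/U) ≥ 1 + log N/U ≥ 1 + 4U ≥ 2`. -/
theorem two_le_root {N U : ℕ} (hU4 : 4 ≤ U) (hN16 : 16 ≤ N)
    (hexpU : Real.exp (4 * (U : ℝ) ^ 2) ≤ Real.log N) : (2 : ℝ) ≤ (N : ℝ) ^ ((1 : ℝ) / U) := by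
  -- adapted from `BaseSavAux.schedule_thresholds`
  have hU4R : (4 : ℝ) ≤ U := by exact_mod_cast hU4
  have hUpos : (0 : ℝ) < U := by linarith
  have hN0 : (0 : ℝ) < N := by exact_mod_cast (by omega : 0 < N)
  have h4U2 : 4 * (U : ℝ) ^ 2 + 1 ≤ Real.log N := le_trans (Real.add_one_le_exp _) hexpU
  have hz_exp : (N : ℝ) ^ ((1 : ℝ) / U) = Real.exp (Real.log N / U) := by
    rw [Real.rpow_def_of_pos hN0]; congr 1; ring
  have hlNU : 4 * (U : ℝ) ≤ Real.log N / U := by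
    rw [le_div_iff₀ hUpos]; nlinarith
  rw [hz_exp]
  calc (2 : ℝ) ≤ Real.log N / U + 1 := by linarith
    _ ≤ Real.exp (Real.log N / U) := Real.add_one_le_exp _

/-- **The quarter-budget arithmetic** (pure real arithmetic in `ℓ = log N`, `P = ℓ^ε`, `N`, `C_s`, `L`,
`R = ℓ^{δ_raw}`).  With `Q = N/(8 ℓ^{t+1} P²)` and the thresholds `8 C_s, 16 L, 8 ≤ P`, `P⁶ ≤ ℓ`,
`8 ℓ^{t+2} ≤ N`, `P⁸ ≤ R`: (1) localisation `2LN/ℓ^{t+2} + 1 ≤ 2Q`; (2) `N/ℓ^{t+2} ≤ Q`; (3) raw error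
`V F'/R ≤ Q` for `V ≤ H P/ℓ`, `H ≤ C_s P`, `F' ≤ N P/ℓ^t`; (4) conversion error `H F' P/ℓ² ≤ Q`;
(5) model-side constant `2 (P/ℓ)(C_s P) ≤ 1`. -/
theorem budget {t : ℕ} {ℓ P N Cs L R : ℝ} (hℓ : 1 < ℓ) (hP1 : 1 ≤ P) (hN : 0 < N) (hCs : 0 ≤ Cs)
    (h8Cs : 8 * Cs ≤ P) (h16L : 16 * L ≤ P) (h8 : 8 ≤ P) (hP6 : P ^ 6 ≤ ℓ)
    (hℓN : 8 * ℓ ^ (t + 2) ≤ N) (hR : P ^ 8 ≤ R) :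
    (2 * L * N / ℓ ^ (t + 2) + 1 ≤ 2 * (N / (8 * (ℓ ^ (t + 1) * P ^ 2)))) ∧
    (N / ℓ ^ (t + 2) ≤ N / (8 * (ℓ ^ (t + 1) * P ^ 2))) ∧
    (∀ V F' H : ℝ, 0 ≤ V → 0 ≤ H → H ≤ Cs * P → V ≤ H * P / ℓ → 0 ≤ F' → F' ≤ N * P / ℓ ^ t →
        V * F' / R ≤ N / (8 * (ℓ ^ (t + 1) * P ^ 2))) ∧
    (∀ H F' : ℝ, 0 ≤ H → H ≤ Cs * P → 0 ≤ F' → F' ≤ N * P / ℓ ^ t →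
        H * F' * P / ℓ ^ 2 ≤ N / (8 * (ℓ ^ (t + 1) * P ^ 2))) ∧
    2 * (P / ℓ) * (Cs * P) ≤ 1 := by
  have hℓ0 : 0 < ℓ := one_pos.trans hℓ
  have hP0 : 0 < P := one_pos.trans_le hP1
  have hP2 : P ^ 2 ≤ P ^ 3 := pow_le_pow_right₀ hP1 (by norm_num)
  have hP3 : P ^ 3 ≤ ℓ := (pow_le_pow_right₀ hP1 (by norm_num : 3 ≤ 6)).trans hP6
  have hPP : P ≤ P ^ 3 := le_self_pow₀ hP1 (by norm_num)
  set Q : ℝ := N / (8 * (ℓ ^ (t + 1) * P ^ 2)) with hQ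
  refine ⟨?_, ?_, ?_, ?_, ?_⟩
  · -- (1) localisation: `T ≤ Q` and `1 ≤ Q`
    have h1 : 2 * L * N / ℓ ^ (t + 2) ≤ Q := by
      rw [hQ, div_le_div_iff₀ (by positivity) (by positivity)]
      calc 2 * L * N * (8 * (ℓ ^ (t + 1) * P ^ 2)) = 16 * L * P ^ 2 * (N * ℓ ^ (t + 1)) := by ring
        _ ≤ P * P ^ 2 * (N * ℓ ^ (t + 1)) := by gcongr
        _ = P ^ 3 * (N * ℓ ^ (t + 1)) := by ring
        _ ≤ ℓ * (N * ℓ ^ (t + 1)) := by gcongr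
        _ = N * ℓ ^ (t + 2) := by ring
    have h2 : 1 ≤ Q := by
      rw [hQ, le_div_iff₀ (by positivity), one_mul]
      have hP2ℓ : P ^ 2 ≤ ℓ := hP2.trans hP3
      calc 8 * (ℓ ^ (t + 1) * P ^ 2) ≤ 8 * (ℓ ^ (t + 1) * ℓ) := by gcongr
        _ = 8 * ℓ ^ (t + 2) := by ring
        _ ≤ N := hℓN
    linarith
  · -- (2) `N/ℓ^{t+2} ≤ Q`
    rw [hQ, div_le_div_iff₀ (by positivity) (by positivity)]
    calc N * (8 * (ℓ ^ (t + 1) * P ^ 2)) = 8 * P ^ 2 * (N * ℓ ^ (t + 1)) := by ring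
      _ ≤ P * P ^ 2 * (N * ℓ ^ (t + 1)) := by gcongr
      _ = P ^ 3 * (N * ℓ ^ (t + 1)) := by ring
      _ ≤ ℓ * (N * ℓ ^ (t + 1)) := by gcongr
      _ = N * ℓ ^ (t + 2) := by ring
  · -- (3) the raw error
    intro V F' H hV0 hH0 hHle hVle hF'0 hF'le
    have hR0 : 0 < R := lt_of_lt_of_le (by positivity) hR
    have hVl : V * ℓ ≤ H * P := (le_div_iff₀ hℓ0).1 hVle
    have hFl : F' * ℓ ^ t ≤ N * P := (le_div_iff₀ (by positivity)).1 hF'le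
    rw [hQ, div_le_div_iff₀ hR0 (by positivity)]
    calc V * F' * (8 * (ℓ ^ (t + 1) * P ^ 2)) = 8 * (V * ℓ) * (F' * ℓ ^ t) * P ^ 2 := by ring
      _ ≤ 8 * (H * P) * (N * P) * P ^ 2 := by gcongr
      _ = 8 * H * (N * P ^ 4) := by ring
      _ ≤ 8 * (Cs * P) * (N * P ^ 4) := by gcongr
      _ = 8 * Cs * (N * P ^ 5) := by ring
      _ ≤ P ^ 3 * (N * P ^ 5) := mul_le_mul_of_nonneg_right (h8Cs.trans hPP) (by positivity)
      _ = N * P ^ 8 := by ring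
      _ ≤ N * R := by gcongr
  · -- (4) the conversion error
    intro H F' hH0 hHle hF'0 hF'le
    have hFl : F' * ℓ ^ t ≤ N * P := (le_div_iff₀ (by positivity)).1 hF'le
    rw [hQ, div_le_div_iff₀ (by positivity) (by positivity)]
    calc H * F' * P * (8 * (ℓ ^ (t + 1) * P ^ 2)) = 8 * H * (F' * ℓ ^ t) * (P ^ 3 * ℓ) := by ring
      _ ≤ 8 * (Cs * P) * (N * P) * (P ^ 3 * ℓ) := by gcongr
      _ = 8 * Cs * P ^ 5 * (N * ℓ) := by ring
      _ ≤ P * P ^ 5 * (N * ℓ) := by gcongr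
      _ = P ^ 6 * (N * ℓ) := by ring
      _ ≤ ℓ * (N * ℓ) := by gcongr
      _ = N * ℓ ^ 2 := by ring
  · -- (5) the model-side constant
    rw [show 2 * (P / ℓ) * (Cs * P) = 2 * Cs * P ^ 2 / ℓ by ring, div_le_one hℓ0]
    calc 2 * Cs * P ^ 2 ≤ 8 * Cs * P ^ 2 := by nlinarith [mul_nonneg hCs (sq_nonneg P)]
      _ ≤ P * P ^ 2 := by gcongr
      _ = P ^ 3 := by ring
      _ ≤ ℓ := hP3

end AssemblyAlongAux

open GeThreeAssemblyAux PrLawTwoAssemblyAux WalshStepSavAux AssemblyAlongAux in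
/-- **`stub_assemblyAlong`** (registered stub of skeleton v2, line `superpoly-band-same-atom`): the assembly of
Bombieri's one-parameter section law ALONG THE SCHEDULE `u = U(N)` from the raw law on the localised body, the
main-term conversion, the preparations and the bookkeeping, concluding `SectionLawSavAt t` with the
singular-series ratio `𝔖/𝔖₋ᵢ` — `AssemblyAlong`.  Saving `2ε`, `ε = min(δ_raw, 1/2)/8`. -/
theorem stub_assemblyAlong : AssemblyAlong := by
  intro hF hC hMT hP hSRB hDens hRawAll t ht hLaw L
  -- the vacuous case `L = 0`
  rcases Nat.eq_zero_or_pos L with hL0 | hLpos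
  · refine ⟨1, one_pos, 0, fun N _ Ψ hΨ hL K _ _ i => ?_⟩
    have h1 : (1 : ℝ) ≤ (L : ℝ) := one_le_of_affLinSize_le Ψ hΨ hL i
    rw [hL0, Nat.cast_zero] at h1
    exact absurd h1 (by norm_num)
  have hL1r : (1 : ℝ) ≤ L := by exact_mod_cast hLpos
  -- constants and exponents
  obtain ⟨hDeg, hEul, hFib⟩ := hP
  obtain ⟨Ndeg, hdeg⟩ := hDeg t L
  obtain ⟨Neul, heul⟩ := hEul t L
  obtain ⟨Cs, hCs0, D, Ns, hSR⟩ := hSRB t L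
  obtain ⟨δr, hδr0, NW, hRawN⟩ := hRawAll t ht L
  obtain ⟨ε, hεdef⟩ : ∃ ε : ℝ, ε = min δr (1 / 2) / 8 := ⟨_, rfl⟩
  have hε0 : 0 < ε := by rw [hεdef]; exact div_pos (lt_min hδr0 one_half_pos) (by norm_num)
  obtain ⟨Nm, hMTN⟩ := hMT t L ε hε0
  obtain ⟨Nf, hFibN⟩ := hFib hDens t ht hLaw L ε hε0
  obtain ⟨Na, hDensN⟩ := hDens ε hε0
  obtain ⟨Nth, hth⟩ := exists_thresholds hε0 hε0 D (8 * Cs + 16 * (L : ℝ) + 8)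
  obtain ⟨Nq, hq⟩ := quantClip_schedule 0
  obtain ⟨N₀, hN₀⟩ := Filter.eventually_atTop.1 ((eventually_logpow_le_self (t + 2)).and
    ((eventually_ge_atTop Nth).and ((eventually_ge_atTop Nq).and ((eventually_ge_atTop Ndeg).and
    ((eventually_ge_atTop Neul).and ((eventually_ge_atTop Ns).and ((eventually_ge_atTop NW).and
    ((eventually_ge_atTop Nm).and ((eventually_ge_atTop Nf).and (eventually_ge_atTop Na))))))))))
  refine ⟨2 * ε, by positivity, N₀, fun N hN Ψ hΨ hL K hK hKN i j' hj' => ?_⟩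
  obtain ⟨heN, hNth, hNq, hNdeg, hNeul, hNs, hNW, hNm, hNf, hNa⟩ := hN₀ N hN
  obtain ⟨hℓ1, hllD, hcP⟩ := hth N hNth
  obtain ⟨-, hN16, hexpU, -⟩ := hq N hNq
  have h2U : (2 : ℝ) ≤ (N : ℝ) ^ ((1 : ℝ) / slowDegree N) :=
    two_le_root (four_le_slowDegree N) hN16 hexpU
  have hN0 : (0 : ℝ) < N := by exact_mod_cast (by omega : 0 < N)
  -- the hypotheses at `N`
  obtain ⟨hS'0, hS0, hSle⟩ := hSR N hNs Ψ hΨ hL i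
  have hdegK := hdeg N hNdeg Ψ hΨ hL K i j'
  have heuli := heul N hNeul Ψ hΨ hL i
  have hFibK := hFibN N hNf Ψ hΨ hL
  have hale := (hDensN N hNa).1
  have hMTi := hMTN N hNm Ψ hΨ hL i
  have hRawK := hRawN N hNW Ψ hΨ hL
  -- notation: `ℓ = log N`, `P = ℓ^ε`, the quarter budget `Q`
  set ℓ : ℝ := Real.log (N : ℝ) with hℓ
  have hℓ0 : 0 < ℓ := by linarith
  obtain ⟨hP1, hP2, hP8, hP6⟩ := powers hℓ1.le hδr0 hεdef
  set P : ℝ := ℓ ^ ε with hPdef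
  have hP0 : 0 < P := by linarith
  have h8Cs : 8 * Cs ≤ P := by linarith
  have h16L : 16 * (L : ℝ) ≤ P := by linarith
  have h8P : 8 ≤ P := by linarith
  obtain ⟨hTQ', hNQ, hE2', hE3', hmc⟩ := budget (t := t) hℓ1 hP1 hN0 hCs0.le h8Cs h16L h8P hP6 heN hP8
  set Q : ℝ := (N : ℝ) / (8 * (ℓ ^ (t + 1) * P ^ 2)) with hQdef
  have hQ0 : 0 ≤ Q := by rw [hQdef]; positivity
  have hEQ : (N : ℝ) / (ℓ ^ (t + 1) * ℓ ^ (2 * ε)) = 8 * Q := by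
    rw [hP2, hQdef]
    field_simp
  rw [hEQ]
  -- the localisation threshold `T = x/Λ = 2LN/ℓ^{t+2}`
  set T : ℝ := xOf L N / lamOf N t with hTdef
  have hT : T = 2 * (L : ℝ) * N / ℓ ^ (t + 2) := rfl
  have hT0 : 0 ≤ T := by rw [hT]; positivity
  have hTQ : T + 1 ≤ 2 * Q := by rw [hT]; exact hTQ'
  -- degenerate / non-degenerate
  by_cases hdg : (∃ p : ℕ, p.Prime ∧ sectionDensity Ψ i p = 1) ∨ singularProduct (Fin.removeNth i Ψ) = 0
  · obtain ⟨hcells, hHB⟩ := hdegK hdg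
    have hRF : singularProduct Ψ / singularProduct (Fin.removeNth i Ψ) *
        (sectionMass Ψ K N (slowDegree N) i j' 1 : ℝ) = 0 := by
      by_cases hS : singularProduct (Fin.removeNth i Ψ) = 0
      · rw [hS, div_zero, zero_mul]
      · rw [← heuli.1 hS]; exact hHB
    refine ⟨1, zero_le_one, one_le_two, fun m _ _ => ?_⟩
    have hmodel : (1 + ((1 : ℝ) - 1) * (-1 : ℝ) ^ m) * modelDensity N (slowDegree N) m *
        (singularProduct Ψ / singularProduct (Fin.removeNth i Ψ)) *
        (sectionMass Ψ K N (slowDegree N) i j' 1 : ℝ) = 0 := by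
      rw [mul_assoc, hRF, mul_zero]
    rw [hcells m, hmodel, Nat.cast_zero, sub_zero, abs_zero]
    positivity
  push Not at hdg
  obtain ⟨hne1, hS⟩ := hdg
  have hlt1 : ∀ p : ℕ, p.Prime → sectionDensity Ψ i p < 1 := fun p hp =>
    lt_of_le_of_ne (sectionDensity_prime_le_one Ψ i hp) (hne1 p hp)
  -- `H = 𝔖/𝔖₋ᵢ`, `0 ≤ H ≤ Cs (log ℓ)^D ≤ Cs P`
  set Hh : ℝ := singularProduct Ψ / singularProduct (Fin.removeNth i Ψ) with hHh
  have hS'pos : 0 < singularProduct (Fin.removeNth i Ψ) := lt_of_le_of_ne hS'0 (Ne.symm hS)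
  have hHeq : sectionH Ψ i = Hh := heuli.1 hS
  have hH0 : 0 ≤ Hh := div_nonneg hS0 hS'0
  have hHle : Hh ≤ Cs * P := by
    have h1 : Hh ≤ Cs * Real.log ℓ ^ D := by rw [hHh, div_le_iff₀ hS'pos]; exact hSle
    exact h1.trans (mul_le_mul_of_nonneg_left hllD hCs0.le)
  obtain ⟨hGle, hconv⟩ := hMTi hlt1 hS
  rw [hHeq] at hGle hconv
  -- the localised body
  set K' : Set (Fin 1 → ℝ) := K ∩ {v | T < (Ψ i).realEval v} with hK'
  have hK'conv : Convex ℝ K' := (hF t Ψ K N (slowDegree N) i j').2.2.2.2.2.2 T hK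
  have hK'sub : K' ⊆ realBox 1 N := Set.inter_subset_left.trans hKN
  have hK'T : K' ⊆ {v | T < (Ψ i).realEval v} := Set.inter_subset_right
  set F : ℝ := (sectionMass Ψ K N (slowDegree N) i j' 1 : ℝ) with hFdef
  set F' : ℝ := (sectionMass Ψ K' N (slowDegree N) i j' 1 : ℝ) with hF'def
  have hF0 : 0 ≤ F := Nat.cast_nonneg _
  have hF'0 : 0 ≤ F' := Nat.cast_nonneg _
  obtain ⟨-, -, -, -, hloc, hmono⟩ := hC t Ψ K N (slowDegree N) i j'
  have hcoeff : (Ψ i).coeff ≠ 0 := hΨ.1 i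
  obtain ⟨hmonoCell, hmonoMass⟩ := hmono K' Set.inter_subset_left
  have hF'F : F' ≤ F := by rw [hF'def, hFdef]; exact_mod_cast hmonoMass 1
  have hFF' : F ≤ F' + (T + 1) := (hloc T hT0 hcoeff 1 le_rfl).2
  -- fibre mass, model densities and cells in log-power currency
  have hFle : F ≤ N * P / ℓ ^ t := hFibK K hK hKN i j' hj'
  have hF'le : F' ≤ N * P / ℓ ^ t := hF'F.trans hFle
  have ha0 : ∀ m, 0 ≤ modelDensity N (slowDegree N) m := fun m =>
    WalshStepAux.modelDensity_nonneg N _ m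
  have hcellF' : ∀ m, (cell Ψ K' N (slowDegree N) (i.insertNth m j') : ℝ) ≤ F' := fun m => by
    rw [hF'def]; exact_mod_cast PrLawTwoAux.cell_le_sectionMass Ψ K' h2U i j' m
  -- the generic model bound `|w a_m H X| ≤ 2 (P/ℓ) (Cs P) X`
  have hmodel_le : ∀ δ' : ℝ, 0 ≤ δ' → δ' ≤ 2 → ∀ (m : ℕ) (X : ℝ), 0 ≤ X →
      |(1 + (δ' - 1) * (-1 : ℝ) ^ m) * modelDensity N (slowDegree N) m * Hh * X| ≤
        2 * (P / ℓ) * (Cs * P) * X := by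
    intro δ' hδ0 hδ2 m X hX
    rw [abs_mul, abs_mul, abs_mul, abs_of_nonneg (ha0 m), abs_of_nonneg hH0, abs_of_nonneg hX]
    have hw := WalshStepAux.abs_parityWeight_le hδ0 hδ2 m
    have h1 : |1 + (δ' - 1) * (-1 : ℝ) ^ m| * modelDensity N (slowDegree N) m ≤ 2 * (P / ℓ) :=
      mul_le_mul hw (hale m) (ha0 m) (by norm_num)
    have h2 : |1 + (δ' - 1) * (-1 : ℝ) ^ m| * modelDensity N (slowDegree N) m * Hh ≤
        2 * (P / ℓ) * (Cs * P) := mul_le_mul h1 hHle hH0 (by positivity)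
    exact mul_le_mul_of_nonneg_right h2 hX
  by_cases hsmall : F' < (N : ℝ) / ℓ ^ (t + 2)
  · -- small localised mass: every cell and the model are below `3Q`
    refine ⟨1, zero_le_one, one_le_two, fun m hm _ => ?_⟩
    have hcellK : (cell Ψ K N (slowDegree N) (i.insertNth m j') : ℝ) ≤ F' + (T + 1) :=
      (hloc T hT0 hcoeff m hm).1.trans (by linarith [hcellF' m])
    have hcell3Q : (cell Ψ K N (slowDegree N) (i.insertNth m j') : ℝ) ≤ 3 * Q := by linarith
    have hF3Q : F ≤ 3 * Q := by linarith
    have hmod : |(1 + ((1 : ℝ) - 1) * (-1 : ℝ) ^ m) * modelDensity N (slowDegree N) m * Hh * F| ≤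
        3 * Q := by
      refine (hmodel_le 1 zero_le_one one_le_two m F hF0).trans ?_
      calc 2 * (P / ℓ) * (Cs * P) * F ≤ 2 * (P / ℓ) * (Cs * P) * (3 * Q) := by gcongr
        _ ≤ 1 * (3 * Q) := mul_le_mul_of_nonneg_right hmc (by positivity)
        _ = 3 * Q := one_mul _
    calc |(cell Ψ K N (slowDegree N) (i.insertNth m j') : ℝ) -
          (1 + ((1 : ℝ) - 1) * (-1 : ℝ) ^ m) * modelDensity N (slowDegree N) m * Hh * F|
        ≤ |(cell Ψ K N (slowDegree N) (i.insertNth m j') : ℝ)| +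
          |(1 + ((1 : ℝ) - 1) * (-1 : ℝ) ^ m) * modelDensity N (slowDegree N) m * Hh * F| :=
          abs_sub _ _
      _ ≤ 3 * Q + 3 * Q := add_le_add (by rw [abs_of_nonneg (Nat.cast_nonneg _)]; exact hcell3Q) hmod
      _ ≤ 8 * Q := by linarith
  · -- large localised mass: the raw law on `K'`
    push Not at hsmall
    obtain ⟨δ', hδ0, hδ2, hraw⟩ := hRawK K' hK'conv hK'sub i j' hj' hlt1 hK'T hsmall
    refine ⟨δ', hδ0, hδ2, fun m hm _ => ?_⟩
    -- notation for the pieces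
    set V : ℝ := ∏ p ∈ Nat.primesBelow ⌈zOf N (slowDegree N)⌉₊, (1 - sectionDensity Ψ i p) with hV
    set w : ℝ := 1 + (δ' - 1) * (-1 : ℝ) ^ m with hw
    set G : ℝ := Real.exp Real.eulerMascheroniConstant * V with hG
    set rat : ℝ := roughCellDensity m (Real.log (xOf L N) / Real.log (zOf N (slowDegree N))) /
      (Real.log (xOf L N) / Real.log (zOf N (slowDegree N))) with hrat
    set c₀ : ℝ := (cell Ψ K N (slowDegree N) (i.insertNth m j') : ℝ) with hc₀
    set c₁ : ℝ := (cell Ψ K' N (slowDegree N) (i.insertNth m j') : ℝ) with hc₁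
    have hrawm : |c₁ - w * rat * G * F'| ≤ V * F' / ℓ ^ δr + (N : ℝ) / ℓ ^ (t + 2) := hraw m hm
    have hconvm : |w * rat * G * F' - w * modelDensity N (slowDegree N) m * Hh * F'| ≤
        Hh * F' * P / ℓ ^ 2 := hconv δ' hδ0 hδ2 m hm F' hF'0
    -- `V ≤ e^γ V ≤ H P/ℓ`
    have hV0 : 0 ≤ V := Finset.prod_nonneg fun p hp =>
      sub_nonneg.mpr (sectionDensity_prime_le_one Ψ i (Nat.prime_of_mem_primesBelow hp))
    have hVle : V ≤ Hh * P / ℓ := by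
      have hG1 : 1 ≤ Real.exp Real.eulerMascheroniConstant :=
        Real.one_le_exp (by linarith [Real.one_half_lt_eulerMascheroniConstant])
      calc V = 1 * V := (one_mul _).symm
        _ ≤ G := mul_le_mul_of_nonneg_right hG1 hV0
        _ ≤ Hh * P / ℓ := hGle
    -- E1: localisation of the cell
    have hE1 : |c₀ - c₁| ≤ 2 * Q := by
      have h1 : c₁ ≤ c₀ := by rw [hc₀, hc₁]; exact_mod_cast hmonoCell (i.insertNth m j')
      have h2 : c₀ ≤ c₁ + (T + 1) := (hloc T hT0 hcoeff m hm).1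
      rw [abs_of_nonneg (by linarith)]
      linarith
    -- E2: the raw error
    have hE2 : V * F' / ℓ ^ δr + (N : ℝ) / ℓ ^ (t + 2) ≤ Q + Q :=
      add_le_add (hE2' V F' Hh hV0 hH0 hHle hVle hF'0 hF'le) hNQ
    -- E3: the conversion error
    have hE3 : Hh * F' * P / ℓ ^ 2 ≤ Q := hE3' Hh F' hH0 hHle hF'0 hF'le
    -- E4: localisation of the fibre mass inside the model
    have hE4 : |w * modelDensity N (slowDegree N) m * Hh * F' -
        w * modelDensity N (slowDegree N) m * Hh * F| ≤ 2 * Q := by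
      rw [show w * modelDensity N (slowDegree N) m * Hh * F' - w * modelDensity N (slowDegree N) m * Hh * F =
        -(w * modelDensity N (slowDegree N) m * Hh * (F - F')) by ring, abs_neg]
      refine (hmodel_le δ' hδ0 hδ2 m (F - F') (by linarith)).trans ?_
      calc 2 * (P / ℓ) * (Cs * P) * (F - F') ≤ 1 * (F - F') :=
            mul_le_mul_of_nonneg_right hmc (by linarith)
        _ ≤ 2 * Q := by linarith
    -- assemble
    calc |c₀ - w * modelDensity N (slowDegree N) m * Hh * F|
        ≤ |c₀ - c₁| + |c₁ - w * rat * G * F'| +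
            |w * rat * G * F' - w * modelDensity N (slowDegree N) m * Hh * F'| +
            |w * modelDensity N (slowDegree N) m * Hh * F' - w * modelDensity N (slowDegree N) m * Hh * F| :=
          abs_sub_le_four _ _ _ _ _
      _ ≤ 2 * Q + (Q + Q) + Q + 2 * Q := by
          gcongr
          · exact hrawm.trans hE2
          · exact hconvm.trans hE3
      _ ≤ 8 * Q := by linarith

end Summit.Parity.GeneralizedHardyLittlewood.Cruxes.CellParityLawSaving.SuperPolyBand

end
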